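import Mathlib
import Summits.Ventures.PercRepro2.Independence
import Summits.Ventures.PercRepro2.Harris
import Summits.Ventures.PercRepro2.HCov
import Summits.Ventures.PercRepro2.CutVertexPaths
import Summits.Ventures.PercRepro2.CutOneFarConn
import Summits.Ventures.PercRepro2.CutTwoFarConn
import Summits.Ventures.PercRepro2.CutTwoFarLaw
import Summits.Ventures.PercRepro2.CutTwoFar
import Summits.Ventures.PercRepro2.CutTwoFarHarris
import Summits.Ventures.PercRepro2.CutTwoFarRootsLaw
import Summits.Ventures.PercRepro2.CutTwoFarRightPat
import Summits.Ventures.PercRepro2.CutTwoFarRBConn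
import Summits.Ventures.PercRepro2.CutTwoFarRBMasses

/-!
# A root and `b` behind a cut vertex, III: THE FOUR-ENDPOINT REDUCTION (blind cell PercRepro2,
typer-1 g50)

The reduction of MINE2-CUTVERTEX.md §13.2 / §13.8 for the class T7 (S3.5, the role pair `{a₁, b}`)
in the kernel: with `v` a cut vertex, `a₁, b` on the left and `a₂, a₃, o` on the right (or at `v`),

  `Gc = δ · ((1 − P) γ(0) + P γ(1)) + q_x · P · ((1 − P) h(0) + P h(1))`

(**`Gc_a1bFar_eq`**), with `P = P_A(a₁ ↔ v) = q_all + q_x1`, `q_x = P_A(b ↔ v, a₁ ↮ v) = q_x2`,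
`δ = P_A(a₁ ↔ v, a₁ ↔ b) − P_A(a₁ ↔ v) · P_A(a₁ ↔ b) = q_all − (q_all + q_x1)(q_all + q_12)` (≥ 0
by Harris on the part, `harris_x1_12`), and the FOUR ENDPOINT NUMBERS `γ(0), γ(1), h(0), h(1)` of
§13.8 — explicit right-side quantities of the one-root world `S = C(a₂)` and the world `W′` of the
roots `(v, a₂)` (`γ(0) = 2[n₃ α + (n₃ₒ n_{x3} − n₃ β)]`, …).  Hence (HCOV) on the class whenever the
four endpoint numbers are nonnegative (**`HCov_a1bFar_of_endpoints`**) — mine-2's reduction of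
the root-far classes to «four B-side numbers ≥ 0» (three of them theorems by BHK / Harris on paper,
`γ(1)` by lemma (L) = `RootLeafB`), here as an exact identity for every weight vector.  Proof: the
bilinear forms of Part II, `∑ q = 1`, `∑ r = 1`, and `ring`.  Own work; standard axioms.
-/

namespace Summit.Ventures.PercRepro2

open CovForm CutVertexM9 UnionCluster

namespace CutTwoFar

section RBFar

variable {V : Type*} {E : Type*} [Fintype E] [DecidableEq E] {R : Type*} [Field R]
variable {ends : E → Sym2 V} {side : E → Bool} {L : Set V} {v : V} {Rt : Set V}

variable (h : CutVertex ends side L v Rt) {o b a₁ a₂ a₃ : V} (p : E → R)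
include h

/-- **The T7 reduction** (MINE2-CUTVERTEX §13.8): with `a₁, b` behind the cut vertex `v`,
`Gc = δ · ((1 − P) γ(0) + P γ(1)) + q_x2 · P · ((1 − P) h(0) + P h(1))`. -/
theorem Gc_a1bFar_eq (h1 : a₁ ∈ L ∨ a₁ = v) (hb : b ∈ L ∨ b = v) (h2 : a₂ ∈ Rt ∨ a₂ = v)
    (h3 : a₃ ∈ Rt ∨ a₃ = v) (ho : o ∈ Rt ∨ o = v) : Gc p ends o a₁ a₂ a₃ b =
    (patProb ends side v a₁ b p ![true, true, true] - (patProb ends side v a₁ b p ![true, true, true] + patProb ends side v a₁ b p ![true, false, false]) * (patProb ends side v a₁ b p ![true, true, true] + patProb ends side v a₁ b p ![false, false, true])) * ((1 - (patProb ends side v a₁ b p ![true, true, true] + patProb ends side v a₁ b p ![true, false, false])) * (2 * (prob p {ω | ¬ Conn ends ω a₃ a₂} * prob p {ω | ¬ Conn ends ω v a₂ ∧ Conn ends ω o v ∧ Conn ends ω a₃ a₂} + (prob p {ω | Conn ends ω o a₂ ∧ ¬ Conn ends ω a₃ a₂} * prob p {ω | ¬ Conn ends ω v a₂ ∧ ¬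 Conn ends ω a₃ a₂} - prob p {ω | ¬ Conn ends ω a₃ a₂} * prob p {ω | ¬ Conn ends ω v a₂ ∧ Conn ends ω o a₂ ∧ ¬ Conn ends ω a₃ a₂}))) + (patProb ends side v a₁ b p ![true, true, true] + patProb ends side v a₁ b p ![true, false, false]) * (2 * (prob p {ω | ¬ Conn ends ω v a₂ ∧ ¬ (Conn ends ω a₃ v ∨ Conn ends ω a₃ a₂)} * (prob p {ω | ¬ Conn ends ω v a₂ ∧ Conn ends ω o v ∧ Conn ends ω a₃ a₂} - prob p {ω | ¬ Conn ends ω v a₂ ∧ Conn ends ω o a₂ ∧ ¬ Conn ends ω a₃ a₂}) + prob p {ω | ¬ Conn ends ω v a₂} * prob p {ω | ¬ Conn ends ω v a₂ ∧ ¬ (Conn ends ω a₃ v ∨ Conn ends ω a₃ a₂)} * prob p {ω | Conn ends ω o a₂ ∧ ¬ Conn ends ω a₃ a₂} + prob p {ω | ¬ Conn ends ω v a₂ ∧ ¬ (Conn ends ω a₃ v ∨ Conn ends ω a₃ a₂) ∧ (Conn ends ω o v ∨ Conn ends ω o a₂)} * (prob p {ω | ¬ Conn ends ω v a₂} * prob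 p {ω | Conn ends ω a₃ a₂} - prob p {ω | ¬ Conn ends ω v a₂ ∧ Conn ends ω a₃ a₂})))) +
      patProb ends side v a₁ b p ![false, true, false] * (patProb ends side v a₁ b p ![true, true, true] + patProb ends side v a₁ b p ![true, false, false]) * ((1 - (patProb ends side v a₁ b p ![true, true, true] + patProb ends side v a₁ b p ![true, false, false])) * (2 * prob p {ω | Conn ends ω v a₂} * (prob p {ω | ¬ Conn ends ω a₃ a₂} * (prob p {ω | ¬ Conn ends ω v a₂ ∧ Conn ends ω o v ∧ ¬ (Conn ends ω a₃ v ∨ Conn ends ω a₃ a₂)} + prob p {ω | ¬ Conn ends ω v a₂ ∧ Conn ends ω o v ∧ Conn ends ω a₃ a₂}) + prob p {ω | Conn ends ω o a₂ ∧ ¬ Conn ends ω a₃ a₂} * prob p {ω | ¬ Conn ends ω v a₂ ∧ Conn ends ω a₃ v} - prob p {ω | ¬ Conn ends ω a₃ a₂} * prob p {ω | ¬ Conn ends ω v a₂ ∧ Conn ends ω o a₂ ∧ Conn ends ω a₃ v})) + (patProb ends side v a₁ b p ![true, true, true] + patProb ends side v a₁ b p ![true, false, false]) * (2 * prob p {ω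 | Conn ends ω v a₂} * (prob p {ω | ¬ Conn ends ω v a₂ ∧ ¬ (Conn ends ω a₃ v ∨ Conn ends ω a₃ a₂) ∧ (Conn ends ω o v ∨ Conn ends ω o a₂)} * prob p {ω | ¬ Conn ends ω v a₂ ∧ ¬ Conn ends ω a₃ a₂} + prob p {ω | ¬ Conn ends ω v a₂ ∧ ¬ (Conn ends ω a₃ v ∨ Conn ends ω a₃ a₂)} * (prob p {ω | ¬ Conn ends ω v a₂ ∧ Conn ends ω o v ∧ Conn ends ω a₃ a₂} - prob p {ω | ¬ Conn ends ω v a₂ ∧ Conn ends ω o a₂ ∧ ¬ Conn ends ω a₃ a₂})))) := by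
  have hq := sum_patProb_transPatterns ends side v a₁ b p
  rw [sum_transPatterns] at hq
  have hr := ratom_sum_transSix ends side v a₂ a₃ o p
  rw [sum_transSix] at hr
  have hqs : patProb ends side v a₁ b p ![false, false, false] = 1 - (patProb ends side v a₁ b p ![true, true, true] + patProb ends side v a₁ b p ![true, false, false] + patProb ends side v a₁ b p ![false, true, false] + patProb ends side v a₁ b p ![false, false, true]) := by
    linear_combination hq
  have hrs : ratom ends side v a₂ a₃ o p ![false, false, false, false, false, false] = 1 - (ratom ends side v a₂ a₃ o p ![true, true, true, true, true, true] + ratom ends side v a₂ a₃ o p ![true, true, false, true, false, false] + ratom ends side v a₂ a₃ o p ![true, false, true, false, true, false] + ratom ends side v a₂ a₃ o p ![true, false, false, false, false, true] + ratom ends side v a₂ a₃ o p ![true, false, false, false, false, false] + ratom ends side v a₂ a₃ o p ![false, true, true, false, false, true] + ratom ends side v a₂ a₃ o p ![false, true, false, false, true, false] + ratom ends side v a₂ a₃ o p ![false, true, false, false, false, false] + ratom ends side v a₂ a₃ o p ![false, false, true, true, false, false] + ratom ends side v a₂ a₃ o p ![false, false, true, false, false, false] + ratom ends side v a₂ a₃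 o p ![false, false, false, true, true, true] + ratom ends side v a₂ a₃ o p ![false, false, false, true, false, false] + ratom ends side v a₂ a₃ o p ![false, false, false, false, true, false] + ratom ends side v a₂ a₃ o p ![false, false, false, false, false, true]) := by
    linear_combination hr
  simp only [Gc, DEF]
  rw [PQ_rb h p h1 h2,
    D_rb h p h1 h2 h3,
    Do_rb h p h1 h2 h3 ho,
    EQbo_rb h p h1 hb h2 ho,
    EQb3_rb h p h1 hb h2 h3,
    EQb3o_rb h p h1 hb h2 h3 ho,
    gap_rb h p h1 hb h2,
    EQo_rb h p h1 h2 ho,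
    EQ3_rb h p h1 h2 h3,
    EQ3o_rb h p h1 h2 h3 ho,
    PDb_rb h p h1 hb h2 h3,
    PDbo_rb h p h1 hb h2 h3 ho,
    e_n3 h p h2 h3,
    e_n3o h p h2 h3 ho,
    e_nx3 h p h2 h3,
    e_bx h p h2,
    e_PQp h p h2,
    e_alpha h p h2 h3 ho,
    e_beta h p h2 h3 ho,
    e_Dp h p h2 h3,
    e_Dpo h p h2 h3 ho,
    e_pi h p h2 h3,
    e_b3 h p h2 h3,
    e_oL3nU h p h2 h3 ho,
    e_3L h p h2 h3,
    e_oH3L h p h2 h3 ho, hqs, hrs]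
  ring

/-- **(HCOV) with a root and `b` behind a cut vertex, from the four endpoint numbers**: if
`γ(0), γ(1), h(0), h(1) ≥ 0` then (HCOV) holds, every admissible weight vector (`δ ≥ 0` by Harris on
the part). -/
theorem HCov_a1bFar_of_endpoints [LinearOrder R] [IsStrictOrderedRing R] (h1 : a₁ ∈ L ∨ a₁ = v)
    (hb : b ∈ L ∨ b = v) (h2 : a₂ ∈ Rt ∨ a₂ = v) (h3 : a₃ ∈ Rt ∨ a₃ = v) (ho : o ∈ Rt ∨ o = v)
    (hp : IsProbVec p) (hg0 : 0 ≤ 2 * (prob p {ω | ¬ Conn ends ω a₃ a₂} * prob p {ω | ¬ Conn ends ω v a₂ ∧ Conn ends ω o v ∧ Conn ends ω a₃ a₂} + (prob p {ω | Conn ends ω o a₂ ∧ ¬ Conn ends ω a₃ a₂} * prob p {ω | ¬ Conn ends ω v a₂ ∧ ¬ Conn ends ω a₃ a₂} - prob p {ω | ¬ Conn ends ω a₃ a₂} * prob p {ω | ¬ Conn ends ω v a₂ ∧ Conn ends ω o a₂ ∧ ¬ Conn ends ω a₃ a₂}))) (hg1 : 0 ≤ 2 * (prob p {ω | ¬ Conn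 ends ω v a₂ ∧ ¬ (Conn ends ω a₃ v ∨ Conn ends ω a₃ a₂)} * (prob p {ω | ¬ Conn ends ω v a₂ ∧ Conn ends ω o v ∧ Conn ends ω a₃ a₂} - prob p {ω | ¬ Conn ends ω v a₂ ∧ Conn ends ω o a₂ ∧ ¬ Conn ends ω a₃ a₂}) + prob p {ω | ¬ Conn ends ω v a₂} * prob p {ω | ¬ Conn ends ω v a₂ ∧ ¬ (Conn ends ω a₃ v ∨ Conn ends ω a₃ a₂)} * prob p {ω | Conn ends ω o a₂ ∧ ¬ Conn ends ω a₃ a₂} + prob p {ω | ¬ Conn ends ω v a₂ ∧ ¬ (Conn ends ω a₃ v ∨ Conn ends ω a₃ a₂) ∧ (Conn ends ω o v ∨ Conn ends ω o a₂)} * (prob p {ω | ¬ Conn ends ω v a₂} * prob p {ω | Conn ends ω a₃ a₂} - prob p {ω | ¬ Conn ends ω v a₂ ∧ Conn ends ω a₃ a₂}))) (hh0 : 0 ≤ 2 * prob p {ω | Conn ends ω v a₂} * (prob p {ω | ¬ Conn ends ω a₃ a₂} * (prob p {ω | ¬ Conn ends ω v a₂ ∧ Conn ends ω o v ∧ ¬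 (Conn ends ω a₃ v ∨ Conn ends ω a₃ a₂)} + prob p {ω | ¬ Conn ends ω v a₂ ∧ Conn ends ω o v ∧ Conn ends ω a₃ a₂}) + prob p {ω | Conn ends ω o a₂ ∧ ¬ Conn ends ω a₃ a₂} * prob p {ω | ¬ Conn ends ω v a₂ ∧ Conn ends ω a₃ v} - prob p {ω | ¬ Conn ends ω a₃ a₂} * prob p {ω | ¬ Conn ends ω v a₂ ∧ Conn ends ω o a₂ ∧ Conn ends ω a₃ v})) (hh1 : 0 ≤ 2 * prob p {ω | Conn ends ω v a₂} * (prob p {ω | ¬ Conn ends ω v a₂ ∧ ¬ (Conn ends ω a₃ v ∨ Conn ends ω a₃ a₂) ∧ (Conn ends ω o v ∨ Conn ends ω o a₂)} * prob p {ω | ¬ Conn ends ω v a₂ ∧ ¬ Conn ends ω a₃ a₂} + prob p {ω | ¬ Conn ends ω v a₂ ∧ ¬ (Conn ends ω a₃ v ∨ Conn ends ω a₃ a₂)} * (prob p {ω | ¬ Conn ends ω v a₂ ∧ Conn ends ω o v ∧ Conn ends ω a₃ a₂} - prob p {ω | ¬ Conn ends ω v a₂ ∧ Conn ends ω o a₂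 ∧ ¬ Conn ends ω a₃ a₂}))) :
    HCov p ends o a₁ a₂ a₃ b := by
  unfold HCov
  rw [Gc_a1bFar_eq h p h1 hb h2 h3 ho]
  have hq : ∀ τ, 0 ≤ patProb ends side v a₁ b p τ := fun τ => prob_nonneg hp _
  have hP1 : (patProb ends side v a₁ b p ![true, true, true] + patProb ends side v a₁ b p ![true, false, false]) ≤ 1 := by
    rw [← prob_L₁_eq]
    exact prob_le_one hp _
  have hδ := harris_x1_12 ends side v a₁ b hp
  exact add_nonneg (mul_nonneg (sub_nonneg.2 hδ) (add_nonneg (mul_nonneg (sub_nonneg.2 hP1) hg0)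
      (mul_nonneg (add_nonneg (hq _) (hq _)) hg1)))
    (mul_nonneg (mul_nonneg (hq _) (add_nonneg (hq _) (hq _)))
      (add_nonneg (mul_nonneg (sub_nonneg.2 hP1) hh0) (mul_nonneg (add_nonneg (hq _) (hq _)) hh1)))

end RBFar

end CutTwoFar

end Summit.Ventures.PercRepro2
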